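/-
Origin: expansion seat `prover-pub-hodgecm-mc-carch-1-g36-0`, handover #CA64 2026-08-21T00:38Z md5 39afd0341693 (736 l.; NEW additive leaf; imports Model.ArchKTypeOfMultOneTorus (#CA63, same kit) + Model.ArchKTypeOfHarm + Model.ArchKTypeOfDefiniteChar34 + Model.HypCensus.KappaPlace; ns HodgeCM.Model.MultOne / HodgeCM.Model; 27 theorems 13 defs; ROWDEP on #CA63; NAMES for audit: HodgeCM.Model.MultOne.archSectionFrameOf_twistU21_blockU · HodgeCM.Model.MultOne.exists_eq_smul_of_admissible · HodgeCM.Model.rank_le_one_of_lineOmega_zero) (`HOME/mc/pub-hodgecm-mc-carch-1/stage68/HodgeCM/Model/ArchKTypeOfMultOne.lean`, md5 39afd0341693, 736 lines);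
landed by the second packager p2 gen 16 (p2-g16) in gate run 68 as `HodgeCM/Model/ArchKTypeOfMultOne.lean` (verbatim).
-/
/-
Copyright (c) 2026 the pub-hodgecm formalisation cell (harness21).  New file, not vendored.
Origin: session prover-pub-hodgecm-mc-carch-1-g36-0 (unit pub-hodgecm-mc-carch-1, C / ARCHDATUM BUILDER gen 36; the (J4-mult1)
input of the (J-Liu-Θ) junction behind E's row 9 `hΘ` — multiplicity at most one of the archimedean `K_∞`-type of a slot — PROVED
in the kernel for the honest line representations), 2026-08-21.
Intended final place: `HodgeCM/Model/ArchKTypeOfMultOne.lean` (NEW additive model-layer leaf, part 2 of 2; imports part 1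
`HodgeCM/Model/ArchKTypeOfMultOneTorus.lean` + installed #CA11/#CA44/binder-2 `KappaPlace`; nothing imports it).
-/
import Summits.HodgeConjecture.HodgeCM.Model.ArchKTypeOfMultOneTorus
import Summits.HodgeConjecture.HodgeCM.Model.ArchKTypeOfHarm_2
import Summits.HodgeConjecture.HodgeCM.Model.ArchKTypeOfDefiniteChar34
import Summits.HodgeConjecture.HodgeCM.Model.HypCensus.KappaPlace

set_option autoImplicit false

/-!
# (J4-mult1) in the kernel: the admissible archimedean families of a line slot have `ℂ`-rank at most one

Cell pub-hodgecm, MODEL layer (construction prover mc-carch-1, gen 36), row 9 `hΘ` junction (J-Liu-Θ), input (J4-mult1).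
Binder-1's #R123 `Model/AdelicThetaDistributionMult` reduces «every saturated theta form of a slot is a value of the slot's
distribution» to ONE archimedean statement, taken there as a HYPOTHESIS in the RANK form
`hrk : Module.rank ℂ ↥(D.admFamilies ωar) ≤ 1` — multiplicity at most one of the `K_∞`-type «`τ₁^∨` at `ι₁`, trivial away from
`ι₁`» in the slot's archimedean Weil representation (a CITE candidate: Howe 1989 (3.13) / Kashiwara–Vergne 1978).  This file
PROVES that statement for the honest line representations of the S pin of record — `lineOmega_k = c_k • cmArchWeilRep e₁ (frameD V)
⟨d_k⟩ hGR_k ∘ (archSectionFrameOf V, 1)` (#CA9) and `lineRepOf … k` at archimedean regime elements (#CA27/#CA44) — with NO cited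
input: the multiplicity bound is a property of the DIAGONAL TORUS of the oscillator representation.

## The argument

* § 0 (part 1 `ArchKTypeOfMultOneTorus`; generic, `𝓢(ℝ^σ)`): `μ₀(diag t) h_α = torusChar α t • h_α` (tree `unitaryOpPi_diagHom_torusPt`, `torusOpPi_hermitePi`); the
  torus characters `torusChar α` are pairwise distinct in `α` (`eq_of_torusChar_eq`, by the tree's `torusProbe`); a simultaneous
  torus eigenvector in `𝓢(ℝ^σ)` is a multiple of ONE Hermite function (`exists_eq_smul_hermitePi_of_torusStable`: the tree's
  `FockInvariantLines.exists_eq_smul_fockBasis_of_torusStable_line` carried through `toL2` and the Bargmann unitary); hence two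
  Schwartz functions with the same torus eigenvalue function are proportional (`exists_eq_smul_of_torusEigen`)
  [Folland 1989, §1.7 (vii), Prop. (4.39), Prop. (4.76) — dictionary only; everything is the tree's kernel theorems].
* § 1 (part 1; any ranks `N, M`): the compact-letter ENGINE of the CM pin at OPERATOR level — ONE continuous unitary character `χ` of
  the universal letter group `Π_v DPK_v` with `ω_∞(letterSection h) f = χ h • 𝔢*⁻¹ (μ₀(cmLetterBlock h) (𝔢* f))` for every `f`
  (`exists_character_letterSection_apply`; = binder-2's `DenseArch` § 1 for a general pin: tree `IsArchWeilDatum.exists_eq_compactWeilRep`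
  on `isArchWeilDatum_repTransport_cmArchWeilRep_of_signs` along the generic `letterSection`).
* § 2 (part 1; `M = 1`): the TORUS LETTERS `torusLetter t` of a line pin (diagonal `V`-letters, trivial `W`-letters) have letter block
  `cmLetterBlock (torusLetter t) = diagHom t` for EVERY `t ∈ (S¹)^{Fin n × places}` (`cmLetterBlock_torusLetter`): for a line the
  `V`-torus exhausts the diagonal torus of the big frame.
* § 3 (part 1) CORE (`exists_eq_smul_of_torusLetter_eigen`): two joint eigenvectors of all `ω_∞(letterSection (torusLetter t))` with the same
  eigenvalue function are proportional.
* § 4 the place of `ι₁`: diagonal elements `blockU (kDiag α β)` of `Stab(x₀) = U(2) × U(1)`, their twist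
  (`twistU21_blockU_kDiag`, the orientation involution `twC` of #CA8's `twistU21` on the circle), and THE SECTION IDENTITY
  `(archSectionFrameOf V (twistU21 (blockU k)), 1) = letterSection (mulSingle v₁ (letterOfK k, 1))` (`archSectionFrameOf_twistU21_blockU`:
  #CA8 `cmBlockSection_twist` + #CA11 `frame_stabilizer_eq_κ'` + binder-2 `letterSectionAt` / `letterSection_mulSingle`); the weights
  of `τ₁^∨ = (weightOf x₀)^∨` on `ℓ₁ = ⟨e₀,·⟩` (`weightOf_dual_blockK_kDiag`) and the coordinate swap (`weightOf_dual_blockK_kSwap`).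
* § 5 away from `ι₁`: a letter section with trivial `v₁`-letter and trivial `W`-letters is `(y, 1)` with `y_{w(ι₁)} = 1`
  (`letterSection_away`), and the frame congruence has an explicit section `archFrameLift` (`G y G⁻¹`, tree `unitaryGroupOfFormCongrOfEq`
  with `formCongr_frameGL`: `(c̄ ⊗ 1)(G)ᵀ (Hm ⊗ 1) G = diag(frameD V) ⊗ 1`), `archFrameCongr (archFrameLift y) = y`.
* § 6 the torus letter `t` splits as `mulSingle v₁ (letterOfK (kDiag (alphaOf t) (betaOf t)), 1) * torusLetter (awayT t)`.
* § 7 MAIN `exists_eq_smul_of_admissible` / `rank_le_one_of_admissible`: for ANY scalar functions `χ` on `U(2,1)` and `c′` on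
  `U(V)(L ⊗ ℝ)`, two families `a, b : W^∨ →ₗ 𝓢((L⁺ ⊗ ℝ)³)` that are (i) `Stab(x₀)`-equivariant of type `τ₁^∨` under
  `u ↦ χ(u) • ω(archSectionFrameOf V u, 1)` and (ii) fixed by `c′(aa) • ω(archFrameCongr aa, 1)` for all `aa` trivial at the place of
  `ι₁` are proportional; every submodule of such families has rank `≤ 1`.  (The value `a ℓ₁` is a joint torus-letter eigenvector with
  an eigenvalue function independent of `a` (§ 4–§ 6), so § 3 applies; `a ↦ a ℓ₁` is injective by the swap.)
* § 8 the four lines of record: **`rank_le_one_of_lineOmega_zero/one/two/three`** — for ANY `ωar` with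
  `har : lineRepOf … k ((aa)^𝔸, 1) = ωar aa ⊗ 1` on the `aa` trivial at the place of `ι₁`, every submodule of families with
  (1) `lineOmega_k u (a ℓ) = a (τ₁^∨ u ℓ)` on `Stab(x₀)` and (2) `ωar aa (a ℓ) = a ℓ` has `Module.rank ℂ ≤ 1`.  At the honest (J4) datum
  `D := thetaDistDatumZeroOf …` (sinst-1 #1250: `D.ωA = lineOmega_zero …`, `(S.P 0).ω = lineRepOf … 0`) this is LITERALLY #R123's
  `hrk` for `D.admFamilies ωar`: `rank_le_one_of_lineOmega_zero … hV ωar (D.admFamilies ωar) har (fun a ha => ha.1) (fun a ha => ha.2)`.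

KERNEL only: 0 records, 0 `def … : Prop`, nothing cited as a hypothesis; data defs are explicit group elements / letters
(`circleUnitary`, `kDiag`, `twC`, `letterOfK`, `swapU`, `kSwap`, `archFrameLift`, `alphaOf`, `betaOf`, `awayT`, abbrevs `ell₁`, `ell₂`, `frameGL`;
part 1: `torusLetterV`, `torusLetter`).  `#print axioms` ⊆ {propext, Classical.choice, Quot.sound}.  One `set_option maxHeartbeats 800000 in`
(the MAIN statement, whose elaboration unifies the pin's group types — as binder-2's `DenseArch` § 1).

## References (dictionary only)

* [Folland1989] G. B. Folland, *Harmonic Analysis in Phase Space*, Princeton UP (1989), §1.7 (vii) (Hermite functions as joint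
  eigenfunctions of the oscillator torus), Prop. (4.39) (the compact group acts on the Fock model by substitution), Prop. (4.76).
* R. Howe, Transcending classical invariant theory, J. AMS 2 (1989), (3.13); M. Kashiwara, M. Vergne, Invent. Math. 44 (1978) —
  the published multiplicity-one statements this file makes unnecessary for row 9.
-/

noncomputable section

open NumberField NumberField.InfinitePlace NumberField.mixedEmbedding IsDedekindDomain MeasureTheory
open scoped Matrix TensorProduct Classical SchwartzMap ComplexConjugate
open Literature.NumberTheory.Automorphic Literature.NumberTheory.Weil1964
open Literature.RepresentationTheory.KonnoKonno2007 Literature.RepresentationTheory.KonnoKonno2007.RealDualPair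
open Literature.NumberTheory.GelbartRogawski1991 Literature.NumberTheory.GelbartRogawski1991.UnitaryDualPair
open Literature.Analysis.SegalBargmann

/-! ## § 4. The frame of record at the place of `ι₁`: diagonal elements of `Stab(x₀)` are torus letters -/

namespace HodgeCM.Model.MultOne

open HodgeCM.Model HodgeCM.Model.HypCensus MulAction
open Literature.Geometry.ComplexHyperbolic.BallModel (U21 x₀ stabilizerEquivK21 blockU blockK mat bmat mat_blockU coe_blockK)
open Literature.NumberTheory.Automorphic.U21 (K21 matA sclD pPlus pPlus_apply)
open Literature.AlgebraicGeometry.ShimuraVarieties.BallForms (isPullbackCocycle_cotangentCocycle weightOf_cotangent_dual_apply)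

section PlaceOne

variable {L : CMField} {ι₁ : L →+* ℂ} (V : HermSpace3 L ι₁) (d : (L : Type)) (hd : IsCMField.complexConj L d = d) (hd0 : d ≠ 0)

/-- A point of the circle as an element of `unitary ℂ`. -/
def circleUnitary (β : Circle) : unitary ℂ :=
  ⟨(β : ℂ), Unitary.mem_iff.mpr
    ⟨by rw [Complex.star_def, ← Circle.coe_inv_eq_conj, ← Circle.coe_mul, inv_mul_cancel, Circle.coe_one],
     by rw [Complex.star_def, ← Circle.coe_inv_eq_conj, ← Circle.coe_mul, mul_inv_cancel, Circle.coe_one]⟩⟩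

/-- (Ported verbatim from the HodgeCMPerL package; no docstring in the source.) -/
@[simp] theorem coe_circleUnitary (β : Circle) : ((circleUnitary β : unitary ℂ) : ℂ) = β := rfl

/-- The diagonal elements `(diag α, β)` of `K21 = U(2) × U(1)`. -/
def kDiag (α : Fin 2 → Circle) (β : Circle) : K21 := (diagHom α, circleUnitary β)

/-- (Ported verbatim from the HodgeCMPerL package; no docstring in the source.) -/
@[simp] theorem matA_kDiag (α : Fin 2 → Circle) (β : Circle) :
    matA (kDiag α β) = Matrix.diagonal fun i => ((α i : Circle) : ℂ) := rfl

/-- (Ported verbatim from the HodgeCMPerL package; no docstring in the source.) -/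
@[simp] theorem sclD_kDiag (α : Fin 2 → Circle) (β : Circle) : sclD (kDiag α β) = β := rfl

/-- The orientation twist of the place of `ι₁` on the circle: identity in the branch `(mk ι₁).embedding = ι₁`, inversion
(= complex conjugation) in the other branch. -/
def twC (L : CMField) (ι₁ : L →+* ℂ) (z : Circle) : Circle := if (InfinitePlace.mk ι₁).embedding = ι₁ then z else z⁻¹

/-- (Ported verbatim from the HodgeCMPerL package; no docstring in the source.) -/
theorem embTwist_coe_circle (z : Circle) : UnitaryGroup.embTwist (L : Type) ι₁ (z : ℂ) = ((twC L ι₁ z : Circle) : ℂ) := by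
  unfold twC
  by_cases h : (InfinitePlace.mk ι₁).embedding = ι₁
  · rw [UnitaryGroup.embTwist_apply_of_eq (L : Type) ι₁ h, if_pos h]
  · rw [UnitaryGroup.embTwist_apply_of_ne (L : Type) ι₁ h, if_neg h, Circle.coe_inv_eq_conj]

/-- **The twist of a diagonal stabiliser element is the diagonal stabiliser element with twisted entries.** -/
theorem twistU21_blockU_kDiag (α : Fin 2 → Circle) (β : Circle) :
    twistU21 L ι₁ (blockU (kDiag α β)) = blockU (kDiag (fun i => twC L ι₁ (α i)) (twC L ι₁ β)) := by
  apply Subtype.ext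
  apply Units.ext
  change mat (twistU21 L ι₁ (blockU (kDiag α β))) = mat (blockU (kDiag (fun i => twC L ι₁ (α i)) (twC L ι₁ β)))
  rw [mat_twistU21, mat_blockU, mat_blockU, matA_kDiag, matA_kDiag, sclD_kDiag, sclD_kDiag]
  ext i j
  fin_cases i <;> fin_cases j <;> simp [bmat, Matrix.diagonal, embTwist_coe_circle]

/-- the `V`-letter at `v₁` of a stabiliser element `k = (A, δ) ∈ U(2) × U(1)`, read in the block labels of the frame of record. -/
def letterOfK (k : K21) :
    Matrix.unitaryGroup (PosIdx (cmXV (L : Type) (frameD V) (frameD_real V) ι₁ (cmPlace (L : Type) ι₁))) ℂ ×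
      Matrix.unitaryGroup (NegIdx (cmXV (L : Type) (frameD V) (frameD_real V) ι₁ (cmPlace (L : Type) ι₁))) ℂ :=
  (reindexUnitary (blockPosEquiv V) k.1, reindexUnitary (blockNegEquiv V) (unitaryToUnit k.2))

/-- (Ported verbatim from the HodgeCMPerL package; no docstring in the source.) -/
theorem reindexUnitary_symm_reindexUnitary {σ σ' : Type} [Fintype σ] [DecidableEq σ] [Fintype σ'] [DecidableEq σ']
    (ε : σ ≃ σ') (U : Matrix.unitaryGroup σ' ℂ) : reindexUnitary ε.symm (reindexUnitary ε U) = U := by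
  apply Subtype.ext
  ext i j
  rw [reindexUnitary_apply, reindexUnitary_apply, Equiv.apply_symm_apply, Equiv.apply_symm_apply]

/-- **The `ι₁`-section of a twisted stabiliser element IS the one-place letter section of its `V`-letter**:
`(archSectionFrameOf V (twistU21 (blockU k)), 1) = letterSection (mulSingle v₁ (letterOfK k, 1))`
(#CA8 `cmBlockSection_twist`, #CA11 `frame_stabilizer_eq_κ'`, binder-2 `letterSectionAt`/`letterSection_mulSingle`). -/
theorem archSectionFrameOf_twistU21_blockU (k : K21) :
    ((archSectionFrameOf V (twistU21 L ι₁ (blockU k)),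
        (1 : UnitaryGroup.arch (↥(maximalRealSubfield L)) L (IsCMField.complexConj L) 1 (Matrix.diagonal (lineVec (L : Type) d)))) :
      UnitaryGroup.arch (↥(maximalRealSubfield L)) L (IsCMField.complexConj L) 3 (Matrix.diagonal (frameD V)) ×
        UnitaryGroup.arch (↥(maximalRealSubfield L)) L (IsCMField.complexConj L) 1 (Matrix.diagonal (lineVec (L : Type) d))) =
      letterSection (L : Type) (frameD V) (frameD_real V) (frameD_ne V) (lineVec (L : Type) d) (fun _ => hd) (fun _ => hd0) ι₁
        (Pi.mulSingle (cmPlace (L : Type) ι₁) (letterOfK V k, 1)) := by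
  rw [← cmBlockSection_twist V (lineVec (L : Type) d) (fun _ => hd) (fun _ => hd0), twistU21_twistU21]
  have hk := frame_stabilizer_eq_κ'
    (R := PosIdx (cmXW (L : Type) (frameD V) (lineVec (L : Type) d) (fun _ => hd) ι₁ (cmPlace (L : Type) ι₁)))
    (S := NegIdx (cmXW (L : Type) (frameD V) (lineVec (L : Type) d) (fun _ => hd) ι₁ (cmPlace (L : Type) ι₁))) (blockK k)
  rw [coe_blockK, show stabilizerEquivK21.symm (blockK k) = k from stabilizerEquivK21.symm_apply_apply k] at hk
  rw [hk, letterSection_mulSingle, letterSectionAt_apply]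
  -- both sides are `archPairSection v₁` of the same element of Konno–Konno's group
  change archPairSection (L : Type) (IsCMField.complexConj L) 3 1 (IsCMField.complexConj_ne_one (L : Type)) (cmPlaceOver (L : Type))
      (cmPlaceOver_smul (L : Type)) (cmPlaceOver_comap (L : Type)) (cmRealVec (L : Type) (frameD V) (frameD_real V))
      (cmRealVec (L : Type) (lineVec (L : Type) d) (fun _ => hd)) (realDiagonal_map (L : Type) (frameD V) (frameD_real V)).symm
      (realDiagonal_map (L : Type) (lineVec (L : Type) d) (fun _ => hd)).symm (cmEpsV (L : Type) (frameD V) (frameD_real V) ι₁)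
      (cmEpsW (L : Type) (frameD V) (lineVec (L : Type) d) (fun _ => hd) ι₁) (cmDV_ne_zero (L : Type) (frameD V) (frameD_real V) (frameD_ne V) ι₁)
      (cmDW_ne_zero (L : Type) (frameD V) (lineVec (L : Type) d) (fun _ => hd) (fun _ => hd0) ι₁) (cmSignConv_ne_zero (L : Type) (frameD V) ι₁)
      (cmCW_ne_zero (L : Type) (frameD V) ι₁) (cm_htV (L : Type) (frameD V) (frameD_real V) (frameD_ne V) ι₁)
      (cm_htW (L : Type) (frameD V) (lineVec (L : Type) d) (fun _ => hd) (fun _ => hd0) ι₁) (UnitaryGroup.complexConj_smul_infinitePlace (L : Type))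
      (cmPlace (L : Type) ι₁)
      ((Ginf.relabel _ _ _ _ (Fin 2) Unit _ _ (blockPosEquiv V) (blockNegEquiv V) (Equiv.refl _) (Equiv.refl _)).symm
        (κ (Fin 2) Unit _ _ ((k.1, unitaryToUnit k.2), 1))) = _
  congr 1
  apply (Ginf.relabel _ _ _ _ (Fin 2) Unit _ _ (blockPosEquiv V) (blockNegEquiv V) (Equiv.refl _) (Equiv.refl _)).injective
  rw [ContinuousMulEquiv.apply_symm_apply]
  symm
  -- `κ (letterOfK k, 1)` relabelled is `κ ((k.1, k.2), 1)` (as in #CA37 `κ_letterK`)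
  rw [Ginf.relabel_apply]
  have h1 : (κ _ _ (PosIdx (cmXW (L : Type) (frameD V) (lineVec (L : Type) d) (fun _ => hd) ι₁ (cmPlace (L : Type) ι₁)))
      (NegIdx (cmXW (L : Type) (frameD V) (lineVec (L : Type) d) (fun _ => hd) ι₁ (cmPlace (L : Type) ι₁))) (letterOfK V k, 1)).1 =
      UForm.kV _ _ (letterOfK V k) := rfl
  have h2 : (κ (Fin 2) Unit (PosIdx (cmXW (L : Type) (frameD V) (lineVec (L : Type) d) (fun _ => hd) ι₁ (cmPlace (L : Type) ι₁)))
      (NegIdx (cmXW (L : Type) (frameD V) (lineVec (L : Type) d) (fun _ => hd) ι₁ (cmPlace (L : Type) ι₁))) ((k.1, unitaryToUnit k.2), 1)).1 =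
      UForm.kV _ _ (k.1, unitaryToUnit k.2) := rfl
  have h3 : (κ _ _ (PosIdx (cmXW (L : Type) (frameD V) (lineVec (L : Type) d) (fun _ => hd) ι₁ (cmPlace (L : Type) ι₁)))
      (NegIdx (cmXW (L : Type) (frameD V) (lineVec (L : Type) d) (fun _ => hd) ι₁ (cmPlace (L : Type) ι₁))) (letterOfK V k, 1)).2 = 1 :=
    map_one (UForm.kV _ _)
  have h4 : (κ (Fin 2) Unit (PosIdx (cmXW (L : Type) (frameD V) (lineVec (L : Type) d) (fun _ => hd) ι₁ (cmPlace (L : Type) ι₁)))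
      (NegIdx (cmXW (L : Type) (frameD V) (lineVec (L : Type) d) (fun _ => hd) ι₁ (cmPlace (L : Type) ι₁))) ((k.1, unitaryToUnit k.2), 1)).2 = 1 :=
    map_one (UForm.kV _ _)
  refine Prod.ext ?_ ?_
  · rw [h1, h2]
    apply Subtype.ext; apply Units.ext
    rw [UForm.coe_relabel, UForm.coe_kV, UForm.coe_kV]
    ext (i | i) (j | j) <;> simp [Matrix.fromBlocks, reindexUnitary_apply, letterOfK]
  · rw [h3, h4, map_one]

/-! ### the `K_∞`-type `τ₁^∨` on diagonal elements and on the coordinate swap -/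

/-- the first coordinate functional `ℓ₁ = ⟨e₀, ·⟩ ∈ W^∨`. -/
abbrev ell₁ : Module.Dual ℂ (Fin 2 → ℂ) := dotProductEquiv ℂ (Fin 2) (Pi.single 0 1)
/-- the second coordinate functional `ℓ₂ = ⟨e₁, ·⟩ ∈ W^∨`. -/
abbrev ell₂ : Module.Dual ℂ (Fin 2 → ℂ) := dotProductEquiv ℂ (Fin 2) (Pi.single 1 1)

/-- **`ℓ₁` is a weight vector of `τ₁^∨` for every diagonal element of `Stab(x₀)`**, weight `δ̄ · α₀`. -/
theorem weightOf_dual_blockK_kDiag (α : Fin 2 → Circle) (β : Circle) :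
    (isPullbackCocycle_cotangentCocycle.weightOf x₀).dual (blockK (kDiag α β)) ell₁ =
      (star ((β : Circle) : ℂ) * ((α 0 : Circle) : ℂ)) • ell₁ := by
  rw [ell₁, weightOf_cotangent_dual_apply, ← Literature.Geometry.ComplexHyperbolic.BallModel.stabilizerEquivK21_apply,
    MulEquiv.symm_apply_apply, pPlus_apply, matA_kDiag, sclD_kDiag, Matrix.diagonal_mulVec_single, mul_one, ← map_smul]
  congr 1
  ext i
  simp [Pi.single_apply]

/-- the coordinate swap of `U(2)`. -/
def swapU : Matrix.unitaryGroup (Fin 2) ℂ :=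
  ⟨!![0, 1; 1, 0], by
    rw [Matrix.mem_unitaryGroup_iff]
    ext i j
    fin_cases i <;> fin_cases j <;> simp [Matrix.mul_apply, Fin.sum_univ_two, Matrix.star_apply]⟩

/-- the element `(swap, 1) ∈ U(2) × U(1)`. -/
def kSwap : K21 := (swapU, 1)

/-- **the coordinate swap of `Stab(x₀)` maps `ℓ₁` to `ℓ₂` under `τ₁^∨`.** -/
theorem weightOf_dual_blockK_kSwap : (isPullbackCocycle_cotangentCocycle.weightOf x₀).dual (blockK kSwap) ell₁ = ell₂ := by
  rw [ell₁, ell₂, weightOf_cotangent_dual_apply, ← Literature.Geometry.ComplexHyperbolic.BallModel.stabilizerEquivK21_apply,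
    MulEquiv.symm_apply_apply, pPlus_apply]
  congr 1
  have h1 : sclD kSwap = 1 := rfl
  have h2 : matA kSwap = !![0, 1; 1, 0] := rfl
  rw [h1, h2, star_one, one_smul]
  ext i
  fin_cases i <;> simp [Matrix.mulVec, dotProduct, Pi.single_apply]

/-- `{ℓ₁, ℓ₂}` separates linear families: a linear map on `W^∨` vanishing on both vanishes. -/
theorem eq_zero_of_apply_ell {X : Type*} [AddCommGroup X] [Module ℂ X] (a : Module.Dual ℂ (Fin 2 → ℂ) →ₗ[ℂ] X)
    (h₁ : a ell₁ = 0) (h₂ : a ell₂ = 0) : a = 0 := by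
  have hcomp : a ∘ₗ (dotProductEquiv ℂ (Fin 2)).toLinearMap = 0 := by
    apply LinearMap.pi_ext'
    intro i
    apply LinearMap.ext_ring
    fin_cases i
    · simpa using h₁
    · simpa using h₂
  have := congrArg (fun f : (Fin 2 → ℂ) →ₗ[ℂ] X => f ∘ₗ (dotProductEquiv ℂ (Fin 2)).symm.toLinearMap) hcomp
  simpa [LinearMap.comp_assoc] using this

end PlaceOne

/-! ## § 5. Away from the place of `ι₁`: letter sections with trivial `v₁`-letter, and the frame congruence -/

section Away

variable {L : CMField} {ι₁ : L →+* ℂ} (V : HermSpace3 L ι₁) (d : (L : Type)) (hd : IsCMField.complexConj L d = d) (hd0 : d ≠ 0)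

/-- **A letter section whose `v₁`-letter is trivial and whose `W`-letters are trivial is `(y, 1)` with `y` trivial at
the place of `ι₁`.** -/
theorem letterSection_away (h : ∀ v : {v : InfinitePlace ↥(maximalRealSubfield L) // v.IsReal},
      DPK (PosIdx (cmXV (L : Type) (frameD V) (frameD_real V) ι₁ v)) (NegIdx (cmXV (L : Type) (frameD V) (frameD_real V) ι₁ v))
        (PosIdx (cmXW (L : Type) (frameD V) (lineVec (L : Type) d) (fun _ => hd) ι₁ v))
        (NegIdx (cmXW (L : Type) (frameD V) (lineVec (L : Type) d) (fun _ => hd) ι₁ v)))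
    (hW : ∀ v, (h v).2 = 1) (h₁ : h (cmPlace (L : Type) ι₁) = 1) :
    UnitaryGroup.archAt (↥(maximalRealSubfield L)) L (IsCMField.complexConj L) 3 (Matrix.diagonal (frameD V))
        (cmPlaceOver (L : Type) (cmPlace (L : Type) ι₁)) (UnitaryGroup.complexConj_smul_infinitePlace (L : Type) _)
        (IsCMField.complexConj_ne_one (L : Type))
        (letterSection (L : Type) (frameD V) (frameD_real V) (frameD_ne V) (lineVec (L : Type) d) (fun _ => hd) (fun _ => hd0) ι₁ h).1 = 1 ∧
      (letterSection (L : Type) (frameD V) (frameD_real V) (frameD_ne V) (lineVec (L : Type) d) (fun _ => hd) (fun _ => hd0) ι₁ h).2 = 1 := by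
  -- the homomorphism `(x, y) ↦ (x_{w₁}, y)`
  let Φ : (UnitaryGroup.arch (↥(maximalRealSubfield L)) L (IsCMField.complexConj L) 3 (Matrix.diagonal (frameD V)) ×
        UnitaryGroup.arch (↥(maximalRealSubfield L)) L (IsCMField.complexConj L) 1 (Matrix.diagonal (lineVec (L : Type) d))) →*
      (UnitaryGroup.archLocal (L : Type) 3 (Matrix.diagonal (frameD V)) (cmPlaceOver (L : Type) (cmPlace (L : Type) ι₁)) ×
        UnitaryGroup.arch (↥(maximalRealSubfield L)) L (IsCMField.complexConj L) 1 (Matrix.diagonal (lineVec (L : Type) d))) :=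
    ((UnitaryGroup.archAt (↥(maximalRealSubfield L)) L (IsCMField.complexConj L) 3 (Matrix.diagonal (frameD V))
        (cmPlaceOver (L : Type) (cmPlace (L : Type) ι₁)) (UnitaryGroup.complexConj_smul_infinitePlace (L : Type) _)
        (IsCMField.complexConj_ne_one (L : Type))).comp (MonoidHom.fst _ _)).prod (MonoidHom.snd _ _)
  suffices hΦ : Φ (letterSection (L : Type) (frameD V) (frameD_real V) (frameD_ne V) (lineVec (L : Type) d) (fun _ => hd) (fun _ => hd0) ι₁ h) = 1 from
    ⟨(Prod.mk.inj hΦ).1, (Prod.mk.inj hΦ).2⟩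
  have hfac : ∀ v, Φ (letterSectionAt (L : Type) (frameD V) (frameD_real V) (frameD_ne V) (lineVec (L : Type) d) (fun _ => hd) (fun _ => hd0) ι₁ v (h v)) = 1 := by
    intro v
    by_cases hv : v = cmPlace (L : Type) ι₁
    · subst hv; rw [h₁, map_one, map_one]
    · have hsplit : h v = ((h v).1, 1) := by rw [← hW v]
      rw [hsplit, letterSectionAt_kV]
      refine Prod.ext ?_ rfl
      change UnitaryGroup.archAt (↥(maximalRealSubfield L)) L (IsCMField.complexConj L) 3 (Matrix.diagonal (frameD V))
          (cmPlaceOver (L : Type) (cmPlace (L : Type) ι₁)) (UnitaryGroup.complexConj_smul_infinitePlace (L : Type) _)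
          (IsCMField.complexConj_ne_one (L : Type))
          (UnitaryGroup.archSingle (↥(maximalRealSubfield L)) L (IsCMField.complexConj L) 3 (Matrix.diagonal (frameD V))
            (IsCMField.complexConj_ne_one (L : Type)) (UnitaryGroup.complexConj_smul_infinitePlace (L : Type))
            (cmPlaceOver (L : Type) v) (uOfLetter (L : Type) (frameD V) (frameD_real V) (frameD_ne V) (lineVec (L : Type) d)
              (fun _ => hd) (fun _ => hd0) ι₁ v (h v).1)) = 1
      exact UnitaryGroup.archAt_archSingle_of_ne _ _ _ _ _ _ _ _ (fun heq => hv (cmPlaceOver_injective (L : Type) heq).symm) _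
  show Φ (Finset.univ.noncommProd (fun v => letterSectionAt (L : Type) (frameD V) (frameD_real V) (frameD_ne V) (lineVec (L : Type) d)
      (fun _ => hd) (fun _ => hd0) ι₁ v (h v)) fun _ _ _ _ hvv' => commute_letterSectionAt (L : Type) (frameD V) (frameD_real V)
        (frameD_ne V) (lineVec (L : Type) d) (fun _ => hd) (fun _ => hd0) ι₁ hvv' _ _) = 1
  rw [Finset.map_noncommProd]
  exact (Finset.noncommProd_eq_pow_card _ _ _ 1 fun v _ => hfac v).trans (one_pow _)

/-- the frame of record as an element of `GL₃(L ⊗ ℝ)`. -/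
abbrev frameGL : GL (Fin 3) (mixedSpace (L : Type)) :=
  Matrix.GeneralLinearGroup.map (NumberField.mixedEmbedding (L : Type)) (frameG V : GL (Fin 3) (L : Type))

/-- **the frame identity over `L ⊗ ℝ`**: `(c̄ ⊗ 1)(G)ᵀ · (Hm ⊗ 1) · G = diag(frameD V) ⊗ 1`. -/
theorem formCongr_frameGL :
    formCongr (UnitaryGroup.conjMixed (↥(maximalRealSubfield L)) (L : Type) (IsCMField.complexConj L)) (frameGL V)
        (UnitaryGroup.archFormOf (L : Type) 3 V.Hm) =
      UnitaryGroup.archFormOf (L : Type) 3 (Matrix.diagonal (frameD V)) := by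
  have hG : ((frameGL V : GL (Fin 3) (mixedSpace (L : Type))) : Matrix (Fin 3) (Fin 3) (mixedSpace (L : Type))) =
      ((frameG V : GL (Fin 3) (L : Type)) : Matrix (Fin 3) (Fin 3) (L : Type)).map (NumberField.mixedEmbedding (L : Type)) := rfl
  have hc : (((frameG V : GL (Fin 3) (L : Type)) : Matrix (Fin 3) (Fin 3) (L : Type)).map (NumberField.mixedEmbedding (L : Type))).map
      (UnitaryGroup.conjMixed (↥(maximalRealSubfield L)) (L : Type) (IsCMField.complexConj L)) =
      (((frameG V : GL (Fin 3) (L : Type)) : Matrix (Fin 3) (Fin 3) (L : Type)).map (cmConjRingHom (L : Type))).map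
        (NumberField.mixedEmbedding (L : Type)) := by
    rw [Matrix.map_map, Matrix.map_map]
    congr 1
    funext x
    exact UnitaryGroup.conjMixed_mixedEmbedding (↥(maximalRealSubfield L)) (L : Type) (IsCMField.complexConj L) x
  rw [formCongr, hG, hc, UnitaryGroup.archFormOf, UnitaryGroup.archFormOf, ← Matrix.transpose_map, ← Matrix.map_mul, ← Matrix.map_mul,
    frame_congr]

/-- **the lift along the frame congruence**: `y ↦ G y G⁻¹`, `U(diag frameD V)(L ⊗ ℝ) → U(V.Hm)(L ⊗ ℝ)`. -/
def archFrameLift (y : UnitaryGroup.arch (↥(maximalRealSubfield L)) L (IsCMField.complexConj L) 3 (Matrix.diagonal (frameD V))) :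
    UnitaryGroup.arch (↥(maximalRealSubfield L)) L (IsCMField.complexConj L) 3 V.Hm :=
  unitaryGroupOfFormCongrOfEq (UnitaryGroup.conjMixed (↥(maximalRealSubfield L)) (L : Type) (IsCMField.complexConj L)) (frameGL V)
    (UnitaryGroup.archFormOf (L : Type) 3 V.Hm) (UnitaryGroup.archFormOf (L : Type) 3 (Matrix.diagonal (frameD V))) (formCongr_frameGL V) y

/-- (Ported verbatim from the HodgeCMPerL package; no docstring in the source.) -/
theorem coe_archFrameLift (y : UnitaryGroup.arch (↥(maximalRealSubfield L)) L (IsCMField.complexConj L) 3 (Matrix.diagonal (frameD V))) :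
    ((archFrameLift V y : UnitaryGroup.arch (↥(maximalRealSubfield L)) L (IsCMField.complexConj L) 3 V.Hm) : GL (Fin 3) (mixedSpace (L : Type))) =
      frameGL V * (y : GL (Fin 3) (mixedSpace (L : Type))) * (frameGL V)⁻¹ := rfl

/-- `archFrameCongr (archFrameLift y) = y`. -/
theorem archFrameCongr_archFrameLift
    (y : UnitaryGroup.arch (↥(maximalRealSubfield L)) L (IsCMField.complexConj L) 3 (Matrix.diagonal (frameD V))) :
    archFrameCongr (L : Type) V.Hm (frameG V) (frameD V) (frame_congr V) (archFrameLift V y) = y := by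
  apply Subtype.ext
  rw [coe_archFrameCongr, coe_archFrameLift]
  group

/-- the lift of an element trivial at a place is trivial there. -/
theorem archAt_archFrameLift_eq_one (w : {w : InfinitePlace (L : Type) // w.IsComplex})
    (y : UnitaryGroup.arch (↥(maximalRealSubfield L)) L (IsCMField.complexConj L) 3 (Matrix.diagonal (frameD V)))
    (hy : UnitaryGroup.archAt (↥(maximalRealSubfield L)) L (IsCMField.complexConj L) 3 (Matrix.diagonal (frameD V)) w
      (UnitaryGroup.complexConj_smul_infinitePlace (L : Type) _) (IsCMField.complexConj_ne_one (L : Type)) y = 1) :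
    UnitaryGroup.archAt (↥(maximalRealSubfield L)) L (IsCMField.complexConj L) 3 V.Hm w
      (UnitaryGroup.complexConj_smul_infinitePlace (L : Type) _) (IsCMField.complexConj_ne_one (L : Type)) (archFrameLift V y) = 1 := by
  have h := coe_archAt_archFrameCongr (L : Type) V.Hm (frameG V) (frameD V) (frame_congr V) w (archFrameLift V y)
  rw [archFrameCongr_archFrameLift, hy, OneMemClass.coe_one] at h
  apply Subtype.ext
  rw [OneMemClass.coe_one]
  have h2 := congrArg (fun z => Matrix.GeneralLinearGroup.map (↑w : InfinitePlace (L : Type)).embedding (frameG V) * z *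
    (Matrix.GeneralLinearGroup.map (↑w : InfinitePlace (L : Type)).embedding (frameG V))⁻¹) h
  simp only [mul_one, mul_inv_cancel] at h2
  rw [h2]
  group

end Away

/-! ## § 6. The torus letters of the line pin of record: `v₁`-part from `Stab(x₀)`, away part -/

section Letters

open HodgeCM.Model.ArchSideTerm (e₁)

variable {L : CMField} {ι₁ : L →+* ℂ} (V : HermSpace3 L ι₁) (d : (L : Type)) (hd : IsCMField.complexConj L d = d) (hd0 : d ≠ 0)

/-- the `U(2)`-torus coordinates of the torus letter `t` at `v₁`, read through `blockPosEquiv V`. -/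
def alphaOf (t : Fin 3 × {v : InfinitePlace ↥(maximalRealSubfield L) // v.IsReal} → Circle) : Fin 2 → Circle := fun j =>
  if 0 < cmXW (L : Type) (frameD V) (lineVec (L : Type) d) (fun _ => hd) ι₁ (cmPlace (L : Type) ι₁) 0 then
    (t (e₁ (((blockPosEquiv V).symm j).1, 0), cmPlace (L : Type) ι₁))⁻¹
  else t (e₁ (((blockPosEquiv V).symm j).1, 0), cmPlace (L : Type) ι₁)

/-- the `U(1)`-coordinate of the torus letter `t` at `v₁`, read through `blockNegEquiv V`. -/
def betaOf (t : Fin 3 × {v : InfinitePlace ↥(maximalRealSubfield L) // v.IsReal} → Circle) : Circle :=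
  if 0 < cmXW (L : Type) (frameD V) (lineVec (L : Type) d) (fun _ => hd) ι₁ (cmPlace (L : Type) ι₁) 0 then
    t (e₁ (((blockNegEquiv V).symm ()).1, 0), cmPlace (L : Type) ι₁)
  else (t (e₁ (((blockNegEquiv V).symm ()).1, 0), cmPlace (L : Type) ι₁))⁻¹


-- port_pkg: scope closed for this part
end Letters
end HodgeCM.Model.MultOne
end
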